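import Literature.Probability.Percolation.CornerWindowSum
import Mathlib.Data.Nat.Log
import HarnessLib

/-!
# Summing window bounds by dyadic levels of the distance to the corner

Topic `Probability/Percolation`.  Support file (proofs, no named fact) for the named fact
`SchrammSmirnov2011_thm_1_7` (the landing count of the proof of Prop. 4.1, Ann. Probab. 39 (2011),
§4): the abstract summation behind "the sum of the window terms along a wall face is small".
Windows `i < M` sit at distances `t i ≥ c` from the corner; the `k`-th DYADIC LEVEL collects the
windows with `2^k c ≤ t i < 2^{k+1} c` (`level`, `pow_level_le`, `lt_pow_level_succ`); if each level
holds at most `B₀ 2^k` windows and a window of level `k` costs at most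
`B (2^k)⁻¹^{1+α} (2^k w / S)^ε` with `ε < α`, the total cost is at most
`B₀ B (w/S)^ε / (1 - 2^{-(α-ε)})` (`sum_le_of_levels`, from `corner_window_sum`).

## References

* O. Schramm, S. Smirnov, *On the scaling limits of planar percolation*, Ann. Probab. 39 (2011)
  1768–1814, arXiv:1101.5820, §4, proof of Prop. 4.1. [SchrammSmirnov2011]
-/

noncomputable section

open Finset Real

namespace Literature.Probability.Percolation

namespace DyadicLevel

/-- The dyadic level of a distance `t ≥ c > 0`: the `k` with `2^k c ≤ t < 2^{k+1} c`. [folklore] -/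
def level (c t : ℝ) : ℕ := Nat.log 2 ⌊t / c⌋₊

/-- Lower bound of the level. [folklore] -/
theorem pow_level_le {c t : ℝ} (hc : 0 < c) (hct : c ≤ t) : (2 : ℝ) ^ level c t * c ≤ t := by
  have h1 : (1 : ℕ) ≤ ⌊t / c⌋₊ := Nat.le_floor (by rw [Nat.cast_one, le_div_iff₀ hc, one_mul]; exact hct)
  have h2 : ((2 ^ Nat.log 2 ⌊t / c⌋₊ : ℕ) : ℝ) ≤ ⌊t / c⌋₊ := by exact_mod_cast Nat.pow_log_le_self 2 (by omega)
  have h3 : (⌊t / c⌋₊ : ℝ) ≤ t / c := Nat.floor_le (div_nonneg (hc.le.trans hct) hc.le)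
  rw [level, ← le_div_iff₀ hc]
  push_cast at h2
  linarith

/-- Upper bound of the level. [folklore] -/
theorem lt_pow_level_succ {c t : ℝ} (hc : 0 < c) : t < (2 : ℝ) ^ (level c t + 1) * c := by
  have h1 : ⌊t / c⌋₊ < 2 ^ (Nat.log 2 ⌊t / c⌋₊ + 1) := Nat.lt_pow_succ_log_self (by norm_num) _
  have h2 : t / c < (⌊t / c⌋₊ : ℝ) + 1 := Nat.lt_floor_add_one _
  have h3 : (⌊t / c⌋₊ : ℝ) + 1 ≤ ((2 ^ (Nat.log 2 ⌊t / c⌋₊ + 1) : ℕ) : ℝ) := by exact_mod_cast h1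
  rw [level, ← div_lt_iff₀ hc]
  push_cast at h3
  linarith

/-- The level is controlled by the index when the distances grow at most geometrically:
if `t ≤ 2^i c` then `level c t ≤ i`. [folklore] -/
theorem level_le {c t : ℝ} (hc : 0 < c) (hct : c ≤ t) {i : ℕ} (hi : t < (2 : ℝ) ^ (i + 1) * c) : level c t ≤ i := by
  by_contra h
  push Not at h
  have h1 := pow_level_le hc hct
  have h2 : (2 : ℝ) ^ (i + 1) ≤ (2 : ℝ) ^ level c t := pow_le_pow_right₀ (by norm_num) h
  nlinarith

/-- **Counting naturals in a real window**: naturals `x` with `u ≤ x < u + len` number at most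
`⌊len⌋₊ + 1`. [folklore] -/
theorem card_le_of_mem_window {s : Finset ℕ} {u len : ℝ} (hlen : 0 ≤ len)
    (h : ∀ x ∈ s, u ≤ (x : ℝ) ∧ (x : ℝ) < u + len) : s.card ≤ ⌊len⌋₊ + 1 := by
  have hsub : s ⊆ Finset.Icc ⌈u⌉₊ (⌈u⌉₊ + ⌊len⌋₊) := by
    intro x hx
    obtain ⟨h1, h2⟩ := h x hx
    rw [Finset.mem_Icc]
    constructor
    · exact Nat.ceil_le.2 h1
    · have h3 : (x : ℝ) < ⌈u⌉₊ + len := lt_of_lt_of_le h2 (by linarith [Nat.le_ceil u])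
      have h4 : ((x - ⌈u⌉₊ : ℕ) : ℝ) < len := by
        rcases le_or_gt ⌈u⌉₊ x with hle | hlt
        · push_cast [Nat.cast_sub hle]; linarith
        · rw [Nat.sub_eq_zero_of_le hlt.le]; push_cast; linarith
      have h5 : x - ⌈u⌉₊ ≤ ⌊len⌋₊ := Nat.le_floor_iff hlen |>.2 h4.le |> fun h => by
        exact Nat.lt_succ_iff.1 (Nat.lt_succ_of_le h)
      omega
  calc s.card ≤ (Finset.Icc ⌈u⌉₊ (⌈u⌉₊ + ⌊len⌋₊)).card := Finset.card_le_card hsub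
    _ = ⌊len⌋₊ + 1 := by rw [Nat.card_Icc]; omega

/-- **The sum over the windows by dyadic levels.** [cite: SchrammSmirnov2011, §4, proof of Prop. 4.1 (the number of bays is bounded off the small-bay event)] -/
theorem sum_le_of_levels {α ε c w S B B₀ : ℝ} (hεα : ε < α) (hc : 0 < c) (hw : 0 ≤ w) (hS : 0 < S) (hB : 0 ≤ B)
    (hB₀ : 0 ≤ B₀) (M : ℕ) (p t : ℕ → ℝ)
    (hct : ∀ i < M, c ≤ t i) (hgrow : ∀ i < M, t i < (2 : ℝ) ^ (i + 1) * c)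
    (hcount : ∀ k, (((Finset.range M).filter fun i => level c (t i) = k).card : ℝ) ≤ B₀ * (2 : ℝ) ^ k)
    (hp : ∀ i < M, p i ≤ B * (((2 : ℝ) ^ level c (t i))⁻¹ ^ (1 + α) * ((2 : ℝ) ^ level c (t i) * w / S) ^ ε)) :
    ∑ i ∈ Finset.range M, p i ≤ B₀ * B * (w / S) ^ ε / (1 - (2 : ℝ) ^ (-(α - ε))) := by
  -- group the windows by level
  have hlev : ∀ i ∈ Finset.range M, level c (t i) ∈ Finset.range M := by
    intro i hi
    rw [Finset.mem_range] at hi ⊢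
    exact lt_of_le_of_lt (level_le hc (hct i hi) (hgrow i hi)) hi
  rw [← Finset.sum_fiberwise_of_maps_to hlev]
  -- the level-`k` contribution
  set q : ℕ → ℝ := fun k => ∑ i ∈ (Finset.range M).filter (fun i => level c (t i) = k), p i with hq
  have hqk : ∀ k < M, q k ≤ B₀ * B * ((2 : ℝ) ^ k * ((2 : ℝ) ^ k)⁻¹ ^ (1 + α) * ((2 : ℝ) ^ k * w / S) ^ ε) := by
    intro k _
    have hterm : ∀ i ∈ (Finset.range M).filter (fun i => level c (t i) = k),
        p i ≤ B * (((2 : ℝ) ^ k)⁻¹ ^ (1 + α) * ((2 : ℝ) ^ k * w / S) ^ ε) := by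
      intro i hi
      rw [Finset.mem_filter, Finset.mem_range] at hi
      have := hp i hi.1
      rwa [hi.2] at this
    calc q k ≤ ∑ i ∈ (Finset.range M).filter (fun i => level c (t i) = k), B * (((2 : ℝ) ^ k)⁻¹ ^ (1 + α) * ((2 : ℝ) ^ k * w / S) ^ ε) :=
          Finset.sum_le_sum hterm
      _ = ((Finset.range M).filter fun i => level c (t i) = k).card * (B * (((2 : ℝ) ^ k)⁻¹ ^ (1 + α) * ((2 : ℝ) ^ k * w / S) ^ ε)) := by
          rw [Finset.sum_const, nsmul_eq_mul]
      _ ≤ B₀ * (2 : ℝ) ^ k * (B * (((2 : ℝ) ^ k)⁻¹ ^ (1 + α) * ((2 : ℝ) ^ k * w / S) ^ ε)) := by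
          have : (0 : ℝ) ≤ B * (((2 : ℝ) ^ k)⁻¹ ^ (1 + α) * ((2 : ℝ) ^ k * w / S) ^ ε) := by positivity
          exact mul_le_mul_of_nonneg_right (hcount k) this
      _ = B₀ * B * ((2 : ℝ) ^ k * ((2 : ℝ) ^ k)⁻¹ ^ (1 + α) * ((2 : ℝ) ^ k * w / S) ^ ε) := by ring
  exact corner_window_sum hεα hw hS (by positivity) M q hqk

end DyadicLevel

end Literature.Probability.Percolation

end
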